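import Summits.QuantumFields.YangMills.Theorems.BalabanUVNodesN15KingModelFullPropagatorByPartsLettersColour
import Summits.QuantumFields.YangMills.Theorems.BalabanUVNodesN15SiteCurvedOperatorEntries
import Summits.QuantumFields.YangMills.Theorems.BalabanUVNodesN15BackgroundMatrixByParts
import HarnessLib

/-!
# BalabanUVNodes ∕ N15 — THE KING-MODEL RUNG, PART Σ-cM (curved reading): THE SHIFT-DEFECT ROW LETTER `hDSh` OF dag-n15-c's BY-PARTS ENTRY-2 THEOREM AT THE CURVED KING
# FAMILY — `𝔇(τ′_μ ⊗ 1, τ_μ ⊗ 1)∘(M_{A∘τ_μ⁻¹}∘Σ_ν((A₀⁻¹ ⊗ 1)∘(N∇*_ν ⊗ 1))pr_ν) ≤ C·(o₁ + a₀(L^K)^{−α})·e^{−δ|y−y′|_T}` on the CLOSED mass range, for EVERY matrix coefficient field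
# `A` with row sums `≤ a₀` and one-coarse-step row oscillation `≤ o₁` (Track A, DAG node N15 = NE2; FAN-OUT v1.1 §N15 s3 «KING-MODEL ∕ RIEMANN-KERNEL RUNG»)

HONEST FRAMING.  Count-neutral KNIT plumbing (cell `pub-ymgap`, seat `pub-ymgap-dag-n15-d` g19; `--kind proof --supports stmt-QuantumFields-27366 --as helper` = K3⁸
`SpineGivenEndpointR13SepCoPHV`).  No new analytic estimate; imports BY NAME this seat's part Σ-cM `…KingModelFullPropagatorByPartsLettersColour` (★★ `hasMaj_shiftDefect_kingSM_massRange`),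
dag-n15-w1's part XXXVI `…N15SiteCurvedOperatorEntries` (p642830: `curvSrcC`, `curvCube`; through it dag-n15-e Ω-b `kingGT`, Ω-a `castT` ∕ `castT_add_unitVec` ∕ `underPtN_castT` ∕
`hasMaj_pullEquiv_comp`, dag-n15-w3 `torStep`) and dag-n15-c FILE 12 `…N15BackgroundMatrixByParts` (`mmulOp_sub`, `pull_comp_mmulOp_translate`; M `mmulOp` ∕ `hasMaj_mmulOp`);
nothing in the tree is modified.

WHY.  dag-n15-w1's architecture of record (INBOX 2026-08-28 16:36Z): the curved King family's operator layer IS dag-n15-c FILE 24's `bgFamilyM₂R` with `G := kingGT` (mass 0), so FILE 24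
★★★ `ne2PlusOperator_twoSided_of_letters` delivers all four (3.42) entries from `U ≡ 1` letters (XLI ∕ XLIII ∕ XXXVIII), the `TwoSidedLetters` bundle, and ONE more displayed row — the
SHIFT-DEFECT ROW LETTER `hDSh` with the colour-MIXING coefficient `M_{A_μ∘τ_μ⁻¹}`, «Σ-c ★★ `hasMaj_shiftDefect_kingS` ⊗ colour».  Part Σ-cM proved that letter in the rung's currency (flat
`(K+1)`-level torus `Tor (fine (L^1·L^K) M)`, King's point pairing `underPtN L K 1 M`, shifts `· + e_κ`); this file READS it on the consumer's carriers — dag-n15-w3's nested fine torus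
`Tor (fine L (fine (L^K) M))` with the one-step block map `blockOf L ·` and the steps `torStep`, through dag-n15-e Ω-a's cast (`castT`: coordinates preserved, a translation homomorphism,
`π∘cast = blockOf L ·`) — for an ARBITRARY matrix coefficient field `A` on the coarse torus with the two row letters the `TwoSidedLetters` bundle carries (clauses 2 and 13: row sums `≤ a₀`,
one-coarse-step row oscillation `≤ o₁`; e.g. dag-n15-w1∕-w3's `curvCoefA … (inl μ)` with dag-n15-w2's rows and `rowOsc_of_fgradMat`).

CONTENTS ([folklore] bookkeeping; 0 def).  `liftBlk_blockOf_blockOf_eq_castT`, `idef_shift_nested_eq_castT` (the cast dictionary on the coloured carriers), ★★ **`curvShiftDefect_letter_massRange`**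
(FILE 24's `hDSh` binder at the curved King family with `(a₀, o₁)` displayed), ★ `curvShiftDefect_letter_rate` (the same in FILE 24's `m_T·a·θ` shape once `(L^K)^{−α} ≤ θ`, `o₁ ≤ aθ`).

HONEST SCOPE ∕ LIMITS.  King's `A = 0` MODEL ([King1986] (2.13) p. 653) `⊗ 1_κ`, `U ≡ 1` letter only; odd `L ≥ 3`, `a > 0`, cubes `2L^e`, `K ≥ 1`, one blocking step, `0 ≤ m² ≤ m₀²`, `0 < α < 1`;
sharp block sup sizes; the coefficient field and its two row letters DISPLAYED; nothing of [B5]∕[B6]∕[B9] asserted ((3.42) p. 397 third entry = SHAPE).  It does NOT discharge entry 2 by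
itself; NE2⁺ NOT PRINTED ∕ NOT proved for d = 4; **N15 is NOT discharged**; K3⁸ OPEN, untouched; counts of record UNMOVED (typed 28∕28 · discharged 5∕27 · A 5∕28); one finite four-torus
programme at fixed `ε` — NOT ℝ⁴, NOT infinite volume, NOT OS, NOT a mass gap, NOT Clay.  0 `sorry`, 0 `def`, standard axioms.  Restate-immune (no Theses import).
Locators: [Balaban1985BackgroundPropagators] Thm 3.1 (3.42)–(3.43) pp. 397–398, (3.52) p. 400, (3.64)–(3.65) p. 402 (mechanism); [King1986] (2.13) p. 653, (2.20) p. 654 (re-indexing),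
p. 664 (pairing), (4.1)–(4.5) p. 670; [Balaban1984PropagatorsI] Prop. 1.2 (1.110)–(1.111) p. 35 (shape), p. 25; [Balaban1984PropagatorsII] (2.156) p. 250.
-/

set_option autoImplicit false

noncomputable section

namespace Summit.QuantumFields.YangMills.BalabanUVNodes.N15.KingModel

open Real Finset Matrix
open scoped BigOperators
open Literature.MathematicalPhysics.QuantumFieldTheory.Balaban1983to89
open Literature.MathematicalPhysics.QuantumFieldTheory.Balaban1983to89.B11SectG (BlockNorm HasMaj)
open Literature.MathematicalPhysics.QuantumFieldTheory.Balaban1983to89.T4EtaRateDefect (idef idef_apply)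
open Literature.MathematicalPhysics.QuantumFieldTheory.Balaban1983to89.T4EtaRateCoeffDefect (pull pull_apply diagK)
open Literature.MathematicalPhysics.QuantumFieldTheory.Balaban1983to89.B5Prop11Plancherel (Tor fine unitVec)
open Literature.MathematicalPhysics.QuantumFieldTheory.King1986.Torus (blockOf tdistT tdistT_nonneg)
open Summit.QuantumFields.YangMills.BalabanUVNodes.N15.VectorPiece (unitTorusGeoS tensorId)
open Summit.QuantumFields.YangMills.BalabanUVNodes.N15.MatrixSpecies (liftMap liftBlk liftEquiv liftEquiv_apply mmulOp hasMaj_mmulOp)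
open Summit.QuantumFields.YangMills.BalabanUVNodes.N15.BackgroundLayer (sumJ fgradAdj mmulOp_sub pull_comp_mmulOp_translate)
open Summit.QuantumFields.YangMills.BalabanUVNodes.N15.CurvedSpecies (torStep)
open Summit.QuantumFields.YangMills.BalabanUVNodes.N15.SiteLayerBg (curvCube curvSrcC)
open Summit.QuantumFields.YangMills.BalabanUVNodes.N15KingModelRung (KingVolIndex)
open Summit.QuantumFields.YangMills.BalabanUVNodes.N15KingModelRung.Curved

variable {d : ℕ} (L : ℕ) [NeZero L]
variable (κ : Type) [Fintype κ] (a : ℝ)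

/-! ## §1 The cast dictionary on the coloured carriers -/

section Cast

variable (K : ℕ) (M : Fin (d + 1) → ℕ) [∀ μ, NeZero (M μ)]

omit [Fintype κ] in
/-- dag-n15-w3's coloured fine blocks `blockOf (L^K) M ∘ blockOf L ·` ARE the rung's coloured fine unit blocks `blockOf (L^K) M ∘ π` read through the colour-lifted cast (Ω-a `underPtN_castT`).
[cite: King1986, p.664 (blocks), (2.20) p.654 (re-indexing)] -/
theorem liftBlk_blockOf_blockOf_eq_castT :
    liftBlk (blockOf (L ^ K) M ∘ blockOf L (fine (L ^ K) M)) κ = liftBlk (blockOf (L ^ K) M ∘ underPtN L K 1 M) κ ∘ liftMap ⇑(castT L K M) κ :=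
  funext fun p => by
    show blockOf (L ^ K) M (blockOf L (fine (L ^ K) M) p.1) = blockOf (L ^ K) M (underPtN L K 1 M (castT L K M p.1))
    rw [underPtN_castT]

omit [Fintype κ] in
/-- THE TWO-GRID DEFECT OF THE LIFTED UNIT SHIFTS THROUGH THE ONE-STEP BLOCK MAP IS THE RUNG's, READ THROUGH THE CAST: for every coarse operator `S`,
`𝔇^{blockOf L ·}(τ′_μ ⊗ 1, S) = (cast ⊗ 1)^* ∘ 𝔇^{π}((· + e′_μ) ⊗ 1, S)` (the cast is a translation homomorphism and `π ∘ cast = blockOf L ·`). [cite: King1986, (2.20) p.654, p.664 (pairing)] -/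
theorem idef_shift_nested_eq_castT (S : (Tor (fine (L ^ K) M) × κ → ℝ) →ₗ[ℝ] (Tor (fine (L ^ K) M) × κ → ℝ)) (μ : Fin (d + 1)) :
    idef (pull (liftMap (blockOf L (fine (L ^ K) M)) κ)) (pull (liftMap (blockOf L (fine (L ^ K) M)) κ)) (pull ⇑(liftEquiv (torStep (fine L (fine (L ^ K) M)) μ) κ)) S =
      pull (liftMap ⇑(castT L K M) κ) ∘ₗ idef (pull (liftMap (underPtN L K 1 M) κ)) (pull (liftMap (underPtN L K 1 M) κ))
        (pull ⇑(liftEquiv (Equiv.addRight (unitVec (fine (L ^ 1 * L ^ K) M) μ)) κ)) S := by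
  refine LinearMap.ext fun g => funext fun p => ?_
  show g (blockOf L (fine (L ^ K) M) (p.1 + unitVec (fine L (fine (L ^ K) M)) μ), p.2) - S g (blockOf L (fine (L ^ K) M) p.1, p.2) =
    g (underPtN L K 1 M (castT L K M p.1 + unitVec (fine (L ^ 1 * L ^ K) M) μ), p.2) - S g (underPtN L K 1 M (castT L K M p.1), p.2)
  rw [← castT_add_unitVec, underPtN_castT, underPtN_castT]

end Cast

/-! ## §2 ★★ FILE 24's `hDSh` at the curved King family -/

section Curved

/-- ★★ **THE SHIFT-DEFECT ROW LETTER OF THE CURVED KING FAMILY** (the displayed row `hDSh` of dag-n15-c FILE 23 `hasMaj_entry2_byParts_matrix₂_of_letters` ∕ FILE 24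
`ne2PlusOperator_twoSided_of_letters` at dag-n15-w1's instances: blocks `blockOf (L^K) M`, one-step block map `blockOf L ·`, steps `torStep`, `G = kingGT = A₀⁻¹ ⊗ 1`, `n = L^K`, right
entries `kingGT ∘ curvSrcC ν`).  For odd `L ≥ 3`, `a > 0`, `m₀² ≥ 0`, `0 < α < 1` there are `δ, C > 0` such that for every index `i`, mass `0 ≤ m² ≤ m₀²` (the site layer's `m² = 0`
included), direction `μ` and EVERY matrix coefficient field `A` on the coarse torus with row sums `Σ_{c′}|A(x)_{cc′}| ≤ a₀` and one-coarse-step row oscillation `Σ_{c′}|A(x)_{cc′} − A(x − e_μ)_{cc′}| ≤ o₁`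
(`a₀, o₁ ≥ 0`):  `𝔇(τ′_μ ⊗ 1, τ_μ ⊗ 1)∘(M_{A∘τ_μ⁻¹}∘Σ_ν((A₀⁻¹ ⊗ 1)∘(N∇*_ν ⊗ 1))pr_ν) ≤ C·(o₁ + a₀·(L^K)^{−α})·e^{−δ|y−y′|_T}` from the doubly lifted coarse unit-block size to the
coloured nested fine one — part Σ-cM ★★ `hasMaj_shiftDefect_kingSM_massRange` with `C_a = M_{A∘τ_μ⁻¹}`, `C_a⁺ = M_A` (dag-n15-c `pull_comp_mmulOp_translate`, `hasMaj_mmulOp`, `mmulOp_sub`),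
read through §1. [cite: Balaban1985BackgroundPropagators, Thm 3.1 (3.42)–(3.43) pp.397–398, (3.52) p.400, (3.64)–(3.65) p.402 (mechanism); King1986, p.664 (pairing), (2.20) p.654, (4.1)–(4.5) p.670; Balaban1984PropagatorsI, Prop. 1.2 (1.110)–(1.111) p.35 (shape)] -/
theorem curvShiftDefect_letter_massRange (hLodd : Odd L) (hL : 2 ≤ L) (ha : 0 < a) {m0sq : ℝ} (hm0 : 0 ≤ m0sq) {α : ℝ} (hα0 : 0 < α) (hα1 : α < 1) :
    ∃ δ C : ℝ, 0 < δ ∧ 0 < C ∧ ∀ (i : KingVolIndex d) (msq : ℝ), 0 ≤ msq → msq ≤ m0sq → ∀ (μ : Fin (d + 1))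
      (A : Tor (fine (L ^ i.K) (curvCube L i)) → Matrix κ κ ℝ) (a₀ o₁ : ℝ), 0 ≤ a₀ → 0 ≤ o₁ →
      (∀ x c, ∑ c', |A x c c'| ≤ a₀) → (∀ x c, ∑ c', |A x c c' - A ((torStep (fine (L ^ i.K) (curvCube L i)) μ).symm x) c c'| ≤ o₁) →
      HasMaj (BlockNorm.ofBlocks (unitTorusGeoS L i.K (curvCube L i) i.Msz) (liftBlk (liftBlk (blockOf (L ^ i.K) (curvCube L i)) κ) (Fin (d + 1))))
        (BlockNorm.ofBlocks (unitTorusGeoS L i.K (curvCube L i) i.Msz) (liftBlk (blockOf (L ^ i.K) (curvCube L i) ∘ blockOf L (fine (L ^ i.K) (curvCube L i))) κ))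
        (idef (pull (liftMap (blockOf L (fine (L ^ i.K) (curvCube L i))) κ)) (pull (liftMap (blockOf L (fine (L ^ i.K) (curvCube L i))) κ))
            (pull ⇑(liftEquiv (torStep (fine L (fine (L ^ i.K) (curvCube L i))) μ) κ)) (pull ⇑(liftEquiv (torStep (fine (L ^ i.K) (curvCube L i)) μ) κ)) ∘ₗ
          (mmulOp (A ∘ ⇑(torStep (fine (L ^ i.K) (curvCube L i)) μ).symm) ∘ₗ sumJ fun ν => kingGT L a msq i.K (curvCube L i) κ ∘ₗ curvSrcC L κ i ν))
        (fun y y' => C * (o₁ + a₀ * ((L : ℝ) ^ i.K) ^ (-α)) * Real.exp (-(δ * tdistT (curvCube L i) y y'))) := by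
  obtain ⟨δ, C, hδ, hC, H⟩ := hasMaj_shiftDefect_kingSM_massRange (d := d) L κ hLodd hL ha hm0 hα0 hα1
  refine ⟨δ, C, hδ, hC, fun i msq hmsq hcap μ A a₀ o₁ ha₀ ho₁ hA hosc => ?_⟩
  have hLr : (0 : ℝ) ≤ (L : ℝ) := Nat.cast_nonneg _
  have hmaj : ∀ y y' : Tor (curvCube L i), 0 ≤ C * (o₁ + a₀ * ((L : ℝ) ^ i.K) ^ (-α)) * Real.exp (-(δ * tdistT (curvCube L i) y y')) := fun _ _ =>
    mul_nonneg (mul_nonneg hC.le (add_nonneg ho₁ (mul_nonneg ha₀ (Real.rpow_nonneg (pow_nonneg hLr _) _)))) (Real.exp_nonneg _)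
  -- the intertwining data of the translated fibrewise-matrix multiplication `C_a = M_{A∘τ_μ⁻¹}`, `C_a⁺ = M_A`
  have hCaS : pull ⇑(liftEquiv (torStep (fine (L ^ i.K) (curvCube L i)) μ) κ) ∘ₗ mmulOp (A ∘ ⇑(torStep (fine (L ^ i.K) (curvCube L i)) μ).symm) =
      mmulOp A ∘ₗ pull ⇑(liftEquiv (torStep (fine (L ^ i.K) (curvCube L i)) μ) κ) := pull_comp_mmulOp_translate A _
  have hCa : HasMaj (BlockNorm.ofBlocks (unitTorusGeoS L i.K (curvCube L i) i.Msz) (liftBlk (blockOf (L ^ i.K) (curvCube L i)) κ))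
      (BlockNorm.ofBlocks (unitTorusGeoS L i.K (curvCube L i) i.Msz) (liftBlk (blockOf (L ^ i.K) (curvCube L i)) κ))
      (mmulOp (A ∘ ⇑(torStep (fine (L ^ i.K) (curvCube L i)) μ).symm)) (diagK fun _ => a₀) :=
    hasMaj_mmulOp (g := unitTorusGeoS L i.K (curvCube L i) i.Msz) (blockOf (L ^ i.K) (curvCube L i)) (fun _ => ha₀) fun x c => hA _ c
  have hOsc : HasMaj (BlockNorm.ofBlocks (unitTorusGeoS L i.K (curvCube L i) i.Msz) (liftBlk (blockOf (L ^ i.K) (curvCube L i)) κ))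
      (BlockNorm.ofBlocks (unitTorusGeoS L i.K (curvCube L i) i.Msz) (liftBlk (blockOf (L ^ i.K) (curvCube L i)) κ))
      (mmulOp A - mmulOp (A ∘ ⇑(torStep (fine (L ^ i.K) (curvCube L i)) μ).symm)) (diagK fun _ => o₁) := by
    rw [← mmulOp_sub]
    exact hasMaj_mmulOp (g := unitTorusGeoS L i.K (curvCube L i) i.Msz) (blockOf (L ^ i.K) (curvCube L i)) (fun _ => ho₁) fun x c => by
      simpa only [Pi.sub_apply, Matrix.sub_apply, Function.comp_apply] using hosc x c
  -- part Σ-cM at `n = 1` on the rung's carriers (`torStep = (· + e_μ)` definitionally)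
  have key := H i.K i.one_le_K 1 i.m (curvCube L i) (fun _ => rfl) msq hmsq hcap i.Msz μ
    (mmulOp (A ∘ ⇑(torStep (fine (L ^ i.K) (curvCube L i)) μ).symm)) (mmulOp A) a₀ o₁ ha₀ ho₁ hCaS hCa hOsc
  simp only [Nat.cast_pow] at key
  -- read through the cast
  rw [idef_shift_nested_eq_castT, LinearMap.comp_assoc, liftBlk_blockOf_blockOf_eq_castT]
  exact hasMaj_pullEquiv_comp (g := unitTorusGeoS L i.K (curvCube L i) i.Msz) (liftBlk (blockOf (L ^ i.K) (curvCube L i) ∘ underPtN L i.K 1 (curvCube L i)) κ)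
    (liftMap ⇑(castT L i.K (curvCube L i)) κ) hmaj key

/-- ★ **THE SAME IN FILE 24's `m_T·a·θ` SHAPE**: if moreover the row sums are `≤ a`, the one-step oscillation is `≤ a·θ` (the `TwoSidedLetters` clauses 2 and 13 at scale `a`, rate `θ`) and the
Hölder loss is dominated by the rate, `(L^K)^{−α} ≤ θ`, then the row is `≤ (2C)·a·θ·e^{−δ|y−y′|_T}`. [cite: Balaban1985BackgroundPropagators, Thm 3.1 (3.42)–(3.43) pp.397–398, (3.64)–(3.65) p.402 (mechanism); King1986, p.664 (pairing)] -/
theorem curvShiftDefect_letter_rate (hLodd : Odd L) (hL : 2 ≤ L) (ha : 0 < a) {m0sq : ℝ} (hm0 : 0 ≤ m0sq) {α : ℝ} (hα0 : 0 < α) (hα1 : α < 1) :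
    ∃ δ C : ℝ, 0 < δ ∧ 0 < C ∧ ∀ (i : KingVolIndex d) (msq : ℝ), 0 ≤ msq → msq ≤ m0sq → ∀ (μ : Fin (d + 1))
      (A : Tor (fine (L ^ i.K) (curvCube L i)) → Matrix κ κ ℝ) (a' θ : ℝ), 0 ≤ a' → 0 ≤ θ → ((L : ℝ) ^ i.K) ^ (-α) ≤ θ →
      (∀ x c, ∑ c', |A x c c'| ≤ a') → (∀ x c, ∑ c', |A x c c' - A ((torStep (fine (L ^ i.K) (curvCube L i)) μ).symm x) c c'| ≤ a' * θ) →
      HasMaj (BlockNorm.ofBlocks (unitTorusGeoS L i.K (curvCube L i) i.Msz) (liftBlk (liftBlk (blockOf (L ^ i.K) (curvCube L i)) κ) (Fin (d + 1))))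
        (BlockNorm.ofBlocks (unitTorusGeoS L i.K (curvCube L i) i.Msz) (liftBlk (blockOf (L ^ i.K) (curvCube L i) ∘ blockOf L (fine (L ^ i.K) (curvCube L i))) κ))
        (idef (pull (liftMap (blockOf L (fine (L ^ i.K) (curvCube L i))) κ)) (pull (liftMap (blockOf L (fine (L ^ i.K) (curvCube L i))) κ))
            (pull ⇑(liftEquiv (torStep (fine L (fine (L ^ i.K) (curvCube L i))) μ) κ)) (pull ⇑(liftEquiv (torStep (fine (L ^ i.K) (curvCube L i)) μ) κ)) ∘ₗ
          (mmulOp (A ∘ ⇑(torStep (fine (L ^ i.K) (curvCube L i)) μ).symm) ∘ₗ sumJ fun ν => kingGT L a msq i.K (curvCube L i) κ ∘ₗ curvSrcC L κ i ν))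
        (fun y y' => C * a' * θ * Real.exp (-(δ * tdistT (curvCube L i) y y'))) := by
  obtain ⟨δ, C, hδ, hC, H⟩ := curvShiftDefect_letter_massRange (d := d) L κ a hLodd hL ha hm0 hα0 hα1
  refine ⟨δ, 2 * C, hδ, by positivity, fun i msq hmsq hcap μ A a' θ ha' hθ hrate hA hosc => ?_⟩
  refine (H i msq hmsq hcap μ A a' (a' * θ) ha' (mul_nonneg ha' hθ) hA hosc).mono fun y y' => mul_le_mul_of_nonneg_right ?_ (Real.exp_nonneg _)
  have h1 : a' * ((L : ℝ) ^ i.K) ^ (-α) ≤ a' * θ := mul_le_mul_of_nonneg_left hrate ha'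
  nlinarith

end Curved

end Summit.QuantumFields.YangMills.BalabanUVNodes.N15.KingModel

end
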